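import Summits.QuantumAdvantage.QuantumAdvantage.Theorems.CubicForrelationNearExactIsExactMmNormalForm
import Summits.QuantumAdvantage.QuantumAdvantage.Theorems.CubicForrelationSignedExactCubicForrelationNotPrBPPStubDualShape

/-!
# Crux `CubicForrelation.NearExactIsExact` (stmt-QuantumAdvantage-14043), line `direct-sum-amplification`, lead c6 cycle 2:
  tools for the balanced-split exclusion at `n = 10`, `θ = 7/8` (file A of `…TenBalanced.lean`)

Bit-vector plumbing (`ind` of a xor / of a unit vector, reading back a sum, the one-coordinate peels
`v ‖ true = (v ‖ false) ⊕ e_last`, `(w ‖ true) ‖ b = ((w ‖ false) ‖ b) ⊕ e_{last−1}`, splitting a sum along the last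
coordinate, algebraic degree under `Fin.snoc · b` and under xor with a constant) and three small arithmetic facts
(`(odd − 2·(±1))² ≥ 1`, `(even − (±1))² ≥ 1`, integers `≥ 1` summing to the number of terms are all `1`), used by the
lead's assembly `ten_splitDerivative_unbalanced` (file `…TenBalanced.lean`): in the window `7/8 < Φ(f,g) < 1` for cubic
`f, g` on 10 bits, the derivative of `g` along its split covector is an UNBALANCED quadratic (the balanced split case of
the `n = 10`, `θ = 7/8` isolation is empty).  Everything is elementary; axioms are the standard three.
-/

set_option linter.dupNamespace false -- D-0017: single-problem summit ⇒ `QuantumAdvantage.QuantumAdvantage` by design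

noncomputable section

namespace Summit.QuantumAdvantage.QuantumAdvantage.Theorems.CubicForrelation.NearExactIsExact

open Finset
open scoped Matrix
open Literature.Computability.QuantumComplexity
open Literature.Computability.QuantumComplexity.BuzetChailloux (bxor zeroVec signOf_sq)
open Summit.QuantumAdvantage.QuantumAdvantage.Theorems.ExactPairsMaioranaMcFarland.Negative (ind ind_apply ind_injective)
open Summit.QuantumAdvantage.QuantumAdvantage.Theorems.SignedExactCubicForrelationNotPrBPP (eq_of_signOf_eq)

/-! ### Bit-vector plumbing: `ind`, reading back, unit vectors, `Fin.snoc` -/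

/-- `ind` of a pointwise xor is the sum of the indicators. [folklore] -/
theorem tb_ind_bxor {n : ℕ} (x t : Fin n → Bool) : ind (bxor x t) = ind x + ind t := by
  funext i
  simp only [ind_apply, Pi.add_apply]
  show (if (x i ^^ t i) = true then (1 : ZMod 2) else 0) = _
  cases x i <;> cases t i <;> decide

/-- `ind` of the zero vector is `0`. [folklore] -/
theorem tb_ind_zeroVec {n : ℕ} : ind (zeroVec : Fin n → Bool) = 0 := by
  funext i; simp [ind_apply, BuzetChailloux.zeroVec]

/-- Reading back a sum `v + ind t` is the xor of the read-backs. [folklore] -/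
theorem tb_rd_add_ind {n : ℕ} (v : Fin n → ZMod 2) (t : Fin n → Bool) :
    (fun i => decide ((v + ind t) i = 1)) = bxor (fun i => decide (v i = 1)) t := by
  funext i
  simp only [Pi.add_apply, ind_apply]
  show decide (v i + (if t i = true then 1 else 0) = 1) = (decide (v i = 1) ^^ t i)
  cases t i <;>
    exact (by decide : ∀ a : ZMod 2, decide (a + (if _ = true then 1 else 0) = 1) = (decide (a = 1) ^^ _)) (v i)

/-- `ind` of a unit vector is `Pi.single`. [folklore] -/
theorem tb_ind_single {n : ℕ} (j : Fin n) : ind (fun i : Fin n => decide (i = j)) = Pi.single j (1 : ZMod 2) := by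
  funext i
  rw [ind_apply, Pi.single_apply]
  by_cases h : i = j <;> simp [h]

/-- The character of a unit vector is the sign of one coordinate. [folklore] -/
theorem tb_twist_single {n : ℕ} (j : Fin n) (x : Fin n → Bool) :
    twist (fun i : Fin n => decide (i = j)) x = signOf (x j) := by
  unfold twist
  rw [Finset.prod_eq_single j]
  · cases x j <;> simp [signOf]
  · intro i _ hij; simp [hij]
  · intro h; exact absurd (Finset.mem_univ j) h

/-- Splitting a sum over `𝔽₂^{k+1}` along the last coordinate. [folklore] -/
theorem tb_sum_snoc {k : ℕ} (φ : (Fin (k + 1) → Bool) → ℝ) :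
    ∑ y, φ y = ∑ v : Fin k → Bool, ∑ b : Bool, φ (Fin.snoc v b) := by
  rw [← (Fin.snocEquiv fun _ : Fin (k + 1) => Bool).sum_comp, Fintype.sum_prod_type, Finset.sum_comm]
  rfl

/-- `v ‖ true = (v ‖ false) ⊕ e_last`. [folklore] -/
theorem tb_snoc_true {k : ℕ} (v : Fin k → Bool) :
    (Fin.snoc v true : Fin (k + 1) → Bool) = bxor (Fin.snoc v false) (fun j => decide (j = Fin.last k)) := by
  funext j
  show (Fin.snoc v true : Fin (k + 1) → Bool) j = ((Fin.snoc v false : Fin (k + 1) → Bool) j ^^ decide (j = Fin.last k))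
  refine Fin.lastCases ?_ (fun i => ?_) j
  · simp [Fin.snoc_last]
  · rw [Fin.snoc_castSucc, Fin.snoc_castSucc]
    simp [Fin.castSucc_lt_last i |>.ne]

/-- `v ‖ b = (v ‖ false) ⊕ (b ∧ e_last)`: the general one-coordinate peel. [folklore] -/
theorem tb_snoc_eq_bxor {k : ℕ} (v : Fin k → Bool) (b : Bool) :
    (Fin.snoc v b : Fin (k + 1) → Bool) =
      bxor (Fin.snoc v false) (fun j => b && decide (j = Fin.last k)) := by
  cases b
  · funext j
    show (Fin.snoc v false : Fin (k + 1) → Bool) j = ((Fin.snoc v false : Fin (k + 1) → Bool) j ^^ (false && _))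
    simp
  · rw [tb_snoc_true]
    rfl

/-- `(w ‖ true) ‖ b = ((w ‖ false) ‖ b) ⊕ e_{last-but-one}`. [folklore] -/
theorem tb_snoc_snoc_true {k : ℕ} (w : Fin k → Bool) (b : Bool) :
    (Fin.snoc (Fin.snoc w true : Fin (k + 1) → Bool) b : Fin (k + 2) → Bool) =
      bxor (Fin.snoc (Fin.snoc w false : Fin (k + 1) → Bool) b) (fun j => decide (j = (Fin.last k).castSucc)) := by
  funext j
  show (Fin.snoc (Fin.snoc w true : Fin (k + 1) → Bool) b : Fin (k + 2) → Bool) j =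
    ((Fin.snoc (Fin.snoc w false : Fin (k + 1) → Bool) b : Fin (k + 2) → Bool) j ^^ decide (j = (Fin.last k).castSucc))
  refine Fin.lastCases ?_ (fun i => ?_) j
  · simp [Fin.snoc_last, (Fin.castSucc_lt_last (Fin.last k)).ne']
  · rw [Fin.snoc_castSucc, Fin.snoc_castSucc]
    have := congrFun (tb_snoc_true w) i
    simpa [Fin.castSucc_inj] using this

/-- Fixing the last coordinate does not raise the algebraic degree. [folklore] -/
theorem tb_isDegLeFun_snoc : ∀ {N d : ℕ} {F : (Fin (N + 1) → Bool) → Bool}, IsDegLeFun d F → ∀ (b : Bool),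
    IsDegLeFun d (fun v : Fin N → Bool => F (Fin.snoc v b)) := by
  intro N d F hF b
  refine nf_isDegLeFun_subst
    (Fin.snoc (fun i : Fin N => (MvPolynomial.X i : MvPolynomial (Fin N) (ZMod 2)))
      (MvPolynomial.C (if b then 1 else 0)))
    (fun i => ?_) (fun v => Fin.snoc v b) (fun v i => ?_) hF
  · refine Fin.lastCases ?_ (fun j => ?_) i
    · rw [Fin.snoc_last]; exact (MvPolynomial.totalDegree_C _).le.trans (Nat.zero_le _)
    · rw [Fin.snoc_castSucc]; exact (MvPolynomial.totalDegree_X _).le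
  · refine Fin.lastCases ?_ (fun j => ?_) i
    · simp only [Fin.snoc_last, MvPolynomial.eval_C]
    · simp only [Fin.snoc_castSucc, MvPolynomial.eval_X]

/-! ### Small arithmetic helpers -/

/-- An odd integer minus `±2` has square `≥ 1`. [folklore] -/
theorem tb_one_le_sq_odd_sub (z : ℤ) (hz : Odd z) (b : Bool) : (1 : ℝ) ≤ ((z : ℝ) - 2 * signOf b) ^ 2 := by
  obtain ⟨m, rfl⟩ := hz
  cases b
  · have h : ((2 * m + 1 : ℤ) : ℝ) - 2 * signOf false = ((2 * m - 1 : ℤ) : ℝ) := by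
      simp [signOf]; ring
    rw [h]
    have h1 : (1 : ℤ) ≤ (2 * m - 1) ^ 2 := by
      rcases le_or_gt 1 m with hm | hm
      · nlinarith
      · have : 2 * m - 1 ≤ -1 := by omega
        nlinarith
    exact_mod_cast h1
  · have h : ((2 * m + 1 : ℤ) : ℝ) - 2 * signOf true = ((2 * m + 3 : ℤ) : ℝ) := by
      simp [signOf]; ring
    rw [h]
    have h1 : (1 : ℤ) ≤ (2 * m + 3) ^ 2 := by
      rcases le_or_gt (-1) m with hm | hm
      · nlinarith
      · have : 2 * m + 3 ≤ -1 := by omega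
        nlinarith
    exact_mod_cast h1

/-- An even integer minus `±1` has square `≥ 1`. [folklore] -/
theorem tb_one_le_sq_even_sub (z : ℤ) (hz : Even z) (b : Bool) : (1 : ℝ) ≤ ((z : ℝ) - signOf b) ^ 2 := by
  obtain ⟨m, rfl⟩ := hz
  cases b
  · have h : ((m + m : ℤ) : ℝ) - signOf false = ((2 * m - 1 : ℤ) : ℝ) := by
      simp [signOf]; ring
    rw [h]
    have h1 : (1 : ℤ) ≤ (2 * m - 1) ^ 2 := by
      rcases le_or_gt 1 m with hm | hm
      · nlinarith
      · have : 2 * m - 1 ≤ -1 := by omega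
        nlinarith
    exact_mod_cast h1
  · have h : ((m + m : ℤ) : ℝ) - signOf true = ((2 * m + 1 : ℤ) : ℝ) := by
      simp [signOf]; ring
    rw [h]
    have h1 : (1 : ℤ) ≤ (2 * m + 1) ^ 2 := by
      rcases le_or_gt 0 m with hm | hm
      · nlinarith
      · have : 2 * m + 1 ≤ -1 := by omega
        nlinarith
    exact_mod_cast h1

/-- If integers `z x ≥ 1` sum to the number of terms, they are all `1`. [folklore] -/
theorem tb_all_one_of_sum_le {α : Type*} (s : Finset α) (z : α → ℤ) (hz : ∀ x ∈ s, 1 ≤ z x)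
    (hs : ∑ x ∈ s, z x ≤ s.card) : ∀ x ∈ s, z x = 1 := by
  by_contra h
  push Not at h
  obtain ⟨x₀, hx₀, hne⟩ := h
  have hlt : 1 < z x₀ := lt_of_le_of_ne (hz x₀ hx₀) (Ne.symm hne)
  have : (s.card : ℤ) < ∑ x ∈ s, z x := by
    calc (s.card : ℤ) = ∑ _x ∈ s, (1 : ℤ) := by simp
      _ < ∑ x ∈ s, z x := Finset.sum_lt_sum hz ⟨x₀, hx₀, hlt⟩
  linarith

/-- Xor with a constant does not raise the algebraic degree. [folklore] -/
theorem tb_isDegLeFun_xor_const {n d : ℕ} {F : (Fin n → Bool) → Bool} (hF : IsDegLeFun d F) (cst : Bool) :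
    IsDegLeFun d (fun x => F x ^^ cst) := by
  cases cst
  · simpa only [Bool.xor_false] using hF
  · obtain ⟨p, hp, hpF⟩ := hF
    refine ⟨p + MvPolynomial.C 1, ?_, fun x => ?_⟩
    · exact (MvPolynomial.totalDegree_add _ _).trans (max_le hp ((MvPolynomial.totalDegree_C _).le.trans (Nat.zero_le _)))
    · show (F x ^^ true) = _
      rw [hpF, polyPhase_apply, polyPhase_apply, map_add, MvPolynomial.eval_C]
      exact (by decide : ∀ a : ZMod 2, (decide (a = 1) ^^ true) = decide (a + 1 = 1)) _

end Summit.QuantumAdvantage.QuantumAdvantage.Theorems.CubicForrelation.NearExactIsExact
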